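import Summits.ResolutionOfSingularities.ResolutionOfSingularities.Theorems.FrobeniusClosingPatchingRelPerfectMonomialRungTargets
import Summits.ResolutionOfSingularities.ResolutionOfSingularities.Theorems.FrobeniusClosingPatchingRelPerfectMonomialPairPrincipalization
import HarnessLib

/-!
# Crux `PatchingRelPerfect` (stmt-ResolutionOfSingularities-16161), chain w52 — TargetsF3 M2 for
# families of AT MOST TWO exponent lists (by content)

[OURS · L1 W5.2 · R-mono / R4 support] The planner's target M2 `DepthTargets.MonomialSumPrincipalization`
(`…MonomialRungTargets.lean`, p502939) asks for a principalization of `monomialSum 𝒦` with centres over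
the cosupport OF THE SUM.  For `|𝒦| ≤ 2` this is exactly the pair theorem
`MonomialCleanup.exists_centreSeq_isLocallyPrincipal_comap` (p500388): the strata `V(K) ∩ V(L)` of a
bad pair lie in `V(monomialIdeal A) ∩ V(monomialIdeal B) = V(monomialIdeal A ⊔ monomialIdeal B)`.
PROVED here: `monomialSum_nil/_cons/_singleton/_pair` and
**`monomialSumPrincipalization_of_length_le_two`** — M2 verbatim with the extra hypothesis
`𝒦.length ≤ 2` (the shape met by the two-monomial `u`-charts of rung R4, tri-1 04:21:57Z (1), and by
idea-2's card E «cross pairs»).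

HONEST SCOPE.  For `|𝒦| ≥ 3` the pairwise method (p503306, Goward-type comparabilities) puts its
centres in the PAIRWISE cosupports, which leave `V(monomialSum 𝒦)` (witness: `I = (x², y², z²)`,
`𝒦 = [D̂_x², D̂_y², D̂_z²]` on `Bl_𝔪`, `monomialSum 𝒦 = ⊤` but `D̂_x ∩ D̂_y ≠ ∅` off the exceptional
divisor); M2 in general is the combinatorial reduction to normal crossings of a Newton polyhedra system
(Molina-Samper, arXiv:1711.08258, Thm. 1 / §5.3; Goward 2005) and is NOT proved in the tree.  Nothing
here is a statement of the manuscript under review.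

## References

* R. Goward, *A simple algorithm for principalization of monomial ideals*, Trans. AMS 357 (2005).
  [Goward2005]
* J. Kollár, *Lectures on Resolution of Singularities* (2007), (3.111) Step 3. [Kollar2007]
-/

-- `Summit.<Summit>.<Sub>.Theorems` with `Sub = Summit` (single-conjunct summit, D-0017)
set_option linter.dupNamespace false

noncomputable section

open CategoryTheory AlgebraicGeometry TopologicalSpace
open Literature.AlgebraicGeometry.Resolution

namespace Summit.ResolutionOfSingularities.ResolutionOfSingularities.Theorems.DepthTargets

universe u

variable {X : Scheme.{u}}

/-- The empty sum is the zero ideal sheaf. [folklore] -/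
@[simp] theorem monomialSum_nil : monomialSum ([] : List (List (X.IdealSheafData × ℕ))) = ⊥ := rfl

/-- Unfolding on a cons. [folklore] -/
@[simp] theorem monomialSum_cons (A : List (X.IdealSheafData × ℕ)) (𝒦 : List (List (X.IdealSheafData × ℕ))) :
    monomialSum (A :: 𝒦) = monomialIdeal A ⊔ monomialSum 𝒦 := rfl

/-- A one-member sum. [folklore] -/
theorem monomialSum_singleton (A : List (X.IdealSheafData × ℕ)) : monomialSum [A] = monomialIdeal A := by
  rw [monomialSum_cons, monomialSum_nil, sup_bot_eq]

/-- A two-member sum. [folklore] -/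
theorem monomialSum_pair (A B : List (X.IdealSheafData × ℕ)) :
    monomialSum [A, B] = monomialIdeal A ⊔ monomialIdeal B := by
  rw [monomialSum_cons, monomialSum_singleton]

/-- **TargetsF3 M2 for families of at most two exponent lists** (verbatim shape of
`MonomialSumPrincipalization` plus `𝒦.length ≤ 2`): a sum of at most two monomial ideals on a common
simple normal crossings boundary of a Noetherian regular scheme is principalized by blowings up of
regular centres over ITS cosupport, with regular top — by the pair theorem
`MonomialCleanup.exists_centreSeq_isLocallyPrincipal_comap`. [cite: Goward2005, §2]
[cite: Kollar2007, (3.111) Step 3] -/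
theorem monomialSumPrincipalization_of_length_le_two :
    ∀ (X : Scheme.{u}) [IsNoetherian X], Scheme.IsRegular X →
    ∀ (Es : List X.IdealSheafData), HasSNC Es →
    ∀ (𝒦 : List (List (X.IdealSheafData × ℕ))), (∀ K ∈ 𝒦, boundaryOf K = Es) → 𝒦 ≠ [] →
      𝒦.length ≤ 2 →
      ∃ s : CentreSeq X, s.AllRegular ∧ s.CentresOver ((monomialSum 𝒦).support : Set X) ∧
        Scheme.IsRegular s.top ∧ IsLocallyPrincipal ((monomialSum 𝒦).comap s.comp) := by
  intro X _ _ Es hEs 𝒦 h𝒦 hne hlen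
  match 𝒦, h𝒦, hne, hlen with
  | [], _, hne, _ => exact absurd rfl hne
  | [A], h𝒦, _, _ =>
    have hA : boundaryOf A = Es := h𝒦 A (by simp)
    obtain ⟨s, hreg, hover, htop, hlp⟩ :=
      MonomialCleanup.exists_centreSeq_isLocallyPrincipal_comap A A rfl (hA ▸ hEs)
    refine ⟨s, hreg, ?_, htop, ?_⟩
    · rwa [monomialSum_singleton, ← sup_idem (monomialIdeal A)]
    · rwa [monomialSum_singleton, ← sup_idem (monomialIdeal A)]
  | [A, B], h𝒦, _, _ =>
    have hA : boundaryOf A = Es := h𝒦 A (by simp)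
    have hB : boundaryOf B = Es := h𝒦 B (by simp)
    obtain ⟨s, hreg, hover, htop, hlp⟩ :=
      MonomialCleanup.exists_centreSeq_isLocallyPrincipal_comap A B (hA.trans hB.symm) (hA ▸ hEs)
    refine ⟨s, hreg, ?_, htop, ?_⟩
    · rwa [monomialSum_pair]
    · rwa [monomialSum_pair]
  | _ :: _ :: _ :: _, _, _, hlen => simp at hlen

end Summit.ResolutionOfSingularities.ResolutionOfSingularities.Theorems.DepthTargets

end
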